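import Literature.AlgebraicGeometry.Frobenioids.Frobenioid
import Literature.AlgebraicGeometry.Frobenioids.KummerClass
import HarnessLib

/-!
# Frobenioids II, Definition 2.1: the Kummer hypotheses hold in a Frobenioid (bridge)

Mochizuki, *The geometry of Frobenioids II*, Kyushu J. Math. **62** (2008) 401–460, §2 Definition 2.1,
author's text p. 16 [cite: MochizukiFrdII2008, Def 2.1 p.16], read against [FrdI] Def. 1.3 and
Remark 1.3.1. `KummerClass.lean` constructs the Kummer class / Kummer map for ANY commutative,
cancellative monoid `O` with an action, under the torsor hypothesis `Kummer.NthRootsDifferByUnits N O`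
("two `N`-th roots of the same element differ by a unit"), and announces that in a Frobenioid all of
this holds for `O = O^⊳(A)` by [FrdI] Def. 1.3 (vi) ("faithfulness up to units"). This file PROVES that
bridge over found's `IsFrobenioid` (`Frobenioid.lean`), for the monoid `O^⊳(A)` of base-identity linear
endomorphisms (`PreFrobenioid.endSubmonoid`):
* every endomorphism of `A` is co-angular (the identity is a co-angular pre-step; [FrdI] Def. 1.3 (iii)(b)),
  so the elements of `O^⊳(A)` are co-angular pre-steps;
* [FrdI] Remark 1.3.1: `O^⊳(A)` is commutative (from Def. 1.3 (iii)(c));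
* `O^⊳(A)` is cancellative (pre-steps are monomorphisms, Def. 1.3 (v)(a); `C` is totally epimorphic);
* `Div : O^⊳(A) → Φ(A)` is multiplicative and `Φ(A)` has injective `N`-th power maps (divisorial:
  integral + saturated + sharp), whence two `N`-th roots of the same element are base-equivalent,
  metrically equivalent co-angular pre-steps and differ by a unit of `O^⊳(A)` by Def. 1.3 (vi) —
  i.e. `Kummer.NthRootsDifferByUnits N O^⊳(A)` for `N ≥ 1`.
Universe: `KummerClass.lean` is stated in `Type` (Mathlib's multiplicative cocycles), so the bridge is
stated for categories `C` with hom-sets in `Type`.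
-/

namespace Literature.AlgebraicGeometry.Frobenioids

open CategoryTheory Opposite PreFrobenioid

universe w v u u'

namespace KummerBridge

variable {D : Type u} [Category.{v} D] {Φ : Dᵒᵖ ⥤ CommMonCat.{w}}
  {C : Type u'} [Category.{0} C] (F : C ⥤ ElemFrobenioid Φ)

/-- `O^⊳(A)` as a type: the base-identity linear endomorphisms of `A` ([FrdI] Def. 1.2 (ii)).
[cite: MochizukiFrdII2008, Def 2.1 (i) p.16] -/
abbrev EndMon (A : C) : Type := ↥(endSubmonoid F A)

/-! ### Elementary bookkeeping in `O^⊳(A)` -/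

/-- In `O^⊳(A)`, `Div` is multiplicative: `Div(g ∘ f) = Div(g) + Div(f)` for base-identity linear `f, g`
([FrdI] Rmk 1.1.1 with `Base = id`, `deg_Fr = 1`). [cite: MochizukiFrdII2008, Def 2.1 (i) p.16] -/
theorem div_mul_endMon {A : C} (f g : EndMon F A) :
    Div F ((f * g : EndMon F A) : End A) = Div F (f : End A) * Div F (g : End A) := by
  change Div F ((g : End A) ≫ (f : End A)) = _
  rw [div_comp, g.2.1, pull_id, f.2.2, PNat.one_coe, pow_one]

/-- `Div(fⁿ) = n · Div(f)` in `O^⊳(A)`. [cite: MochizukiFrdII2008, Def 2.1 (i) p.16] -/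
theorem div_pow_endMon {A : C} (f : EndMon F A) (n : ℕ) :
    Div F ((f ^ n : EndMon F A) : End A) = Div F (f : End A) ^ n := by
  induction n with
  | zero => rw [pow_zero, pow_zero]; exact div_id F A
  | succ n ih => rw [pow_succ, div_mul_endMon, ih, pow_succ]

variable {F}

/-- An element of `O^⊳(A)` is a pre-step (linear; `Base = id` is an isomorphism).
[cite: MochizukiFrdII2008, Def 2.1 (i) p.16] -/
theorem isPreStep_of_mem {A : C} {f : A ⟶ A} (hf : f ∈ endSubmonoid F A) : IsPreStep F f := by
  refine ⟨hf.2, ?_⟩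
  change IsIso (Base F f)
  rw [hf.1]
  infer_instance

/-- In a totally epimorphic `C` the identity is co-angular: in a factorisation `𝟙 = α ∘ β ∘ γ` every
factor is an isomorphism. [cite: MochizukiFrdII2008, Def 2.1 (i) p.16] -/
theorem isCoAngular_id (hC : IsTotallyEpimorphic C) (A : C) : IsCoAngular F (𝟙 A) := by
  intro X Y γ β α h _ _ _ _
  haveI : IsIso (γ ≫ β ≫ α) := by rw [h]; infer_instance
  have h1 := hC.isIso_of_isIso_comp γ (β ≫ α)
  haveI : IsIso (β ≫ α) := h1.1
  exact (hC.isIso_of_isIso_comp β α).2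

variable (hF : IsFrobenioid F)
include hF

/-- In a Frobenioid every endomorphism of `A` is co-angular ([FrdI] Def. 1.3 (iii)(b) applied to the
co-angular pre-step `𝟙_A`). [cite: MochizukiFrdII2008, Def 2.1 (i) p.16] -/
theorem isCoAngular_endo {A : C} (f : A ⟶ A) : IsCoAngular F f :=
  hF.iii_b (𝟙 A) ⟨isCoAngular_id hF.isPreFrobenioid.isTotallyEpimorphic A,
    isPreStep_of_mem ⟨base_id F A, degFr_id F A⟩⟩ f

/-- The elements of `O^⊳(A)` are co-angular pre-steps. [cite: MochizukiFrdII2008, Def 2.1 (i) p.16] -/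
theorem isCoAngularPreStep_of_mem {A : C} {f : A ⟶ A} (hf : f ∈ endSubmonoid F A) :
    IsCoAngularPreStep F f :=
  ⟨isCoAngular_endo hF f, isPreStep_of_mem hf⟩

/-- **[FrdI] Remark 1.3.1** ("if `C` is a Frobenioid, then the monoid `O^⊳(A)` is commutative", from
Def. 1.3 (iii)(b)(c)): the bijection `O^⊳(A) ≃ O^⊳(A)` induced by a co-angular pre-step `b : A → A` agrees
with the one induced by `𝟙_A`, i.e. is the identity, so `b ∘ a = a ∘ b`.
[cite: MochizukiFrdI2008, Rmk. 1.3.1 p.25] -/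
theorem comp_comm {A : C} (a b : EndMon F A) : (a : End A) ≫ (b : End A) = (b : End A) ≫ (a : End A) := by
  obtain ⟨e, he⟩ := hF.iii_c (b : End A) (isCoAngularPreStep_of_mem hF b.2)
  have hid : IsCoAngularPreStep F (𝟙 A) := isCoAngularPreStep_of_mem hF ⟨base_id F A, degFr_id F A⟩
  have hbase : Base F (b : End A) = Base F (𝟙 A) := by rw [b.2.1, base_id]
  have key := hF.iii_c_base (b : End A) (𝟙 A) (isCoAngularPreStep_of_mem hF b.2) hid hbase a (e a) a
    (he a) (by rw [Category.id_comp, Category.comp_id])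
  have := he a
  rw [key] at this
  exact this.symm

/-- `O^⊳(A)` is a commutative monoid ([FrdI] Rmk 1.3.1). [cite: MochizukiFrdI2008, Rmk. 1.3.1 p.25] -/
@[reducible] def commMonoid (A : C) : CommMonoid (EndMon F A) :=
  { (inferInstance : Monoid (EndMon F A)) with
    mul_comm := fun a b => Subtype.ext (comp_comm hF b a) }

/-- `O^⊳(A)` is cancellative: on one side because pre-steps are monomorphisms ([FrdI] Def. 1.3 (v)(a)),
on the other because `C` is totally epimorphic. [cite: MochizukiFrdII2008, Def 2.1 (i) p.16] -/
theorem isCancelMul (A : C) : IsCancelMul (EndMon F A) where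
  mul_left_cancel a b c h := by
    haveI : Mono (a : End A) := hF.v_a _ (isPreStep_of_mem a.2)
    have h' : (b : End A) ≫ (a : End A) = (c : End A) ≫ (a : End A) := congrArg Subtype.val h
    exact Subtype.ext ((cancel_mono (a : End A)).mp h')
  mul_right_cancel a b c h := by
    haveI : Epi (a : End A) := hF.isPreFrobenioid.isTotallyEpimorphic.epi _
    have h' : (a : End A) ≫ (b : End A) = (a : End A) ≫ (c : End A) := congrArg Subtype.val h
    exact Subtype.ext ((cancel_epi (a : End A)).mp h')

omit hF in
/-- In a divisorial monoid (integral, saturated, sharp) the `N`-th power map is injective for `N ≥ 1`: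
`a^N = b^N ⇒ a = b`. [cite: MochizukiFrdI2008, Def. 1.1(i)] -/
theorem pow_injective_of_isDivisorial {M : Type w} [CommMonoid M] (hM : IsDivisorial M) {N : ℕ}
    (hN : 0 < N) {a b : M} (h : a ^ N = b ^ N) : a = b := by
  have hint := hM.isPreDivisorial.isIntegral.injective_of
  -- `x := of a / of b` satisfies `x^N = 1`, hence lies in the image of `M` by saturation
  set x : Algebra.GrothendieckGroup M := Algebra.GrothendieckGroup.of a / Algebra.GrothendieckGroup.of b
  have hx : x ^ N = 1 := by
    rw [div_pow, ← map_pow, ← map_pow, h, div_self']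
  obtain ⟨c, hc⟩ := hM.isPreDivisorial.isSaturated.mem_range_of_pow_mem_range x N hN
    ⟨1, by rw [map_one, hx]⟩
  -- `c^N ↦ 1`, so `c^N = 1`, so `c = 1` (sharp ⇒ torsion-free), so `a = b`
  have hcN : c ^ N = 1 := hint (by rw [map_pow, hc, hx, map_one])
  have hc1 : c = 1 := hM.isSharp.isTorsionFree.eq_one_of_pow_eq_one c N hN hcN
  rw [hc1, map_one] at hc
  have : Algebra.GrothendieckGroup.of a = Algebra.GrothendieckGroup.of b := by
    rw [← mul_one (Algebra.GrothendieckGroup.of b), hc, mul_div_cancel]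
  exact hint this

/-- Two `N`-th roots in `O^⊳(A)` of the same element have the same zero divisor (`Φ(A)` is divisorial).
[cite: MochizukiFrdII2008, Def 2.1 (ii) p.16] -/
theorem div_eq_of_pow_eq {A : C} {N : ℕ} (hN : 0 < N) {g g' : EndMon F A}
    (h : g' ^ N = g ^ N) : Div F (g' : End A) = Div F (g : End A) := by
  apply pow_injective_of_isDivisorial (hF.isPreFrobenioid.isDivisorial (baseObj F A)) hN
  rw [← div_pow_endMon, ← div_pow_endMon, h]

/-- A unit of `C` at `A` (an element of `O^×(A) ⊆ Aut_C(A)`) as a unit of the monoid `O^⊳(A)`.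
[cite: MochizukiFrdII2008, Def 2.1 (i) p.16] -/
def unitOfAut {A : C} (α : Aut A) (hα : α ∈ unitsSubgroup F A) : (EndMon F A)ˣ where
  val := ⟨α.hom, hα⟩
  inv := ⟨α.inv, (unitsSubgroup F A).inv_mem hα⟩
  val_inv := Subtype.ext α.inv_hom_id
  inv_val := Subtype.ext α.hom_inv_id

/-- **The bridge** (FrdII Def. 2.1 (ii), "[i.e., the subset of `N`-th roots of `f` — cf. [FrdI],
Definition 1.3, (vi)]"): in a Frobenioid, two `N`-th roots `g, g'` (`N ≥ 1`) of the same element of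
`O^⊳(A)` differ by a unit — they are base-equivalent, metrically equivalent co-angular pre-steps, so
[FrdI] Def. 1.3 (vi) applies. [cite: MochizukiFrdII2008, Def 2.1 (ii) p.16] -/
theorem nthRootsDifferByUnits (A : C) {N : ℕ} (hN : 0 < N) :
    letI := commMonoid hF A
    Kummer.NthRootsDifferByUnits N (EndMon F A) := by
  letI := commMonoid hF A
  refine ⟨fun g g' h => ?_⟩
  have hdiv : MetricallyEquivalent F (g' : End A) (g : End A) := div_eq_of_pow_eq hF hN h
  have hbase : BaseEquivalent F (g' : End A) (g : End A) := by
    change Base F (g' : End A) = Base F (g : End A)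
    rw [g'.2.1, g.2.1]
  obtain ⟨α, hα, hαg⟩ := hF.vi (g' : End A) (g : End A) (isCoAngularPreStep_of_mem hF g'.2)
    (isCoAngularPreStep_of_mem hF g.2) hbase hdiv
  refine ⟨unitOfAut α hα, Subtype.ext ?_⟩
  -- `g' = α ∘ g`, i.e. `g ≫ α.hom = g'`
  exact hαg.symm

end KummerBridge

end Literature.AlgebraicGeometry.Frobenioids
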